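import Mathlib
import HarnessLib
import Summits.ValiantsHypothesis.ValiantsHypothesis.Theses.MonotoneRestoration
import Literature.Computability.AlgebraicComplexity.ArithCircuit
import Literature.Computability.AlgebraicComplexity.ArithCircuitProofs
import Literature.Computability.AlgebraicComplexity.MonotoneStructure
import Literature.Computability.AlgebraicComplexity.PermanentIrreducible
import Literature.ModelTheory.FiniteModelTheory.CkEquiv
import Summits.ValiantsHypothesis.ValiantsHypothesis.Theorems.MonotoneRestorationMonotoneRestorationQPCosetCount
import Summits.ValiantsHypothesis.ValiantsHypothesis.Theorems.MonotoneRestorationMonotoneRestorationQPSymmetricLB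
import Summits.ValiantsHypothesis.ValiantsHypothesis.Theorems.MonotoneRestorationMonotoneRestorationQPSupportSymmetrisation
import Summits.ValiantsHypothesis.ValiantsHypothesis.Theorems.MonotoneRestorationMonotoneRestorationQPSparseRegime
import Summits.ValiantsHypothesis.ValiantsHypothesis.Theorems.MonotoneRestorationMonotoneRestorationQPBeta
import Literature.Computability.AlgebraicComplexity.SymmetricArithCircuit
import Literature.Computability.AlgebraicComplexity.DawarWilsenach2025Proofs
import Literature.GroupTheory.PermutationGroups.SmallIndexSubgroups
import Summits.ValiantsHypothesis.ValiantsHypothesis.Theorems.MonotoneRestorationQP.Negative.LoadBearing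
import Summits.ValiantsHypothesis.ValiantsHypothesis.Theorems.MonotoneRestorationMonotoneRestorationQPPermSupportCount

/-! TTRL-lite variant V19028 of stmt-ValiantsHypothesis-15886

Move `lemma_proposal` (boundary probe): "a monotone computation of `f` gives, via the tree's scalar
combinator `ArithCircuit.smul c`, a monotone computation of `c • f`".  This is FALSE: `P.smul c`
appends the weighted sum gate `sum [(c, P.output)]`, which is plain (`IsPlainGate`) only when
`c = 1`.  It pins why, in the Jerrum–Snir model, weights have to be realised by product gates with a
constant input (the factor `3` in `stub_monotoneComputation_of_complexity`).
-/

-- `Summit.ValiantsHypothesis.ValiantsHypothesis.…` is the tree's mandated single-conjunct layout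
-- (Sub = Summit), so the duplicated namespace component is intended.
set_option linter.dupNamespace false

namespace Summit.ValiantsHypothesis.ValiantsHypothesis.Theorems

open Summit.ValiantsHypothesis.ValiantsHypothesis.Theses.MonotoneRestoration
open Literature.Computability.AlgebraicComplexity

/-- **TTRL-lite variant V19028 of `stub_monotoneComputation_of_complexity` is FALSE** (move
`lemma_proposal`): `ArithCircuit.smul` does not preserve `IsMonotoneComputation`.

Witness: `σ = Unit`, `P = ArithCircuit.ofConst 0` (a monotone computation of `C 0`,
`isMonotoneComputation_ofConst`), `c = 2`.  Then `P.smul 2` has the single gate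
`sum [(2, const 0)]`, whose coefficient `2 ≠ 1`, so it is not plain (`isPlainGate_sum_iff`) and
`P.smul 2` is not a monotone computation of anything. -/
theorem stub_monotoneComputation_of_complexity_var19028_false :
    ¬ (∀ (σ : Type) (P : ArithCircuit NNReal σ) (f : MvPolynomial σ NNReal) (c : NNReal),
        Literature.Barriers.ValiantsHypothesis.IsMonotoneComputation P f →
        Literature.Barriers.ValiantsHypothesis.IsMonotoneComputation (P.smul c) (c • f)) := by
  intro h
  have h0 := (Literature.Barriers.ValiantsHypothesis.isMonotoneComputation_ofConst
    (σ := Unit) (0 : NNReal)).1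
  obtain ⟨-, hplain, -⟩ := h Unit (ArithCircuit.ofConst 0) (MvPolynomial.C 0) 2 h0
  have hg := hplain (ArithCircuit.Gate.sum [((2 : NNReal), ArithCircuit.Operand.const 0)])
    (by simp [ArithCircuit.smul, ArithCircuit.ofConst])
  rw [Literature.Barriers.ValiantsHypothesis.isPlainGate_sum_iff] at hg
  have h21 := hg ((2 : NNReal), ArithCircuit.Operand.const 0) (by simp)
  norm_num at h21

end Summit.ValiantsHypothesis.ValiantsHypothesis.Theorems
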